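import Summits.CriticalPhenomena.PercolationContinuityZ3.Theorems.PercNearOneGluingNoHeavyLowerTailAntipodalR1TwoCutGraded
import Summits.CriticalPhenomena.PercolationContinuityZ3.Theorems.PercNearOneGluingNoHeavyLowerTailAntipodalR1TwoCutContract
import HarnessLib

/-!
# ANTI₁ across a 2-separation, IX: the graded reduction in contraction form

Support file for `stmt-CriticalPhenomena-4575` (memo `prim-gen-kcluster/KCLUSTER-gen76.md` §2, graded
form; conjecture ANTI₁-GRADED of `KCLUSTER-gen52.md` §3).  No definitions, no named facts, no sorries.
Vocabulary of `AntipodalR1` (gen 62), parts V (contraction), VI–VIII (component counts, grades, graded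
reduction) of gen 78.

The third hypothesis of the graded 2-cut reduction (`card_lSet_grade_le_of_twoCut`, part VIII) is the
graded fibre inequality for `G₁ + e_O + e_K`.  Here we identify its levels with the levels of the
CONTRACTION `G₁ / uv` (the system `fun i => (ends₁ i).map π`, `π w = if w = v then u else w`, on the same
vertex type, `v` surviving as an isolated vertex): for `u ≠ v` the grade of `ω₁` in `G₁ / uv` is the grade
of `ω₁ ⊕ id` in `G₁ + e_O + e_K` plus `2` (`grade_contract_eq`: per colour the isolated vertex `v` is one
extra component, `card_cc_contract_eq`).  Hence the graded 2-cut reduction with hypotheses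
ANTI₁-GRADED(`G₁`), ANTI₁-GRADED(`G₁ + uv`), ANTI₁-GRADED(`G₁ / uv`) — all three on systems with fewer
edges than `G` as soon as `G₂` has at least two edges (`card_lSet_grade_le_of_twoCut'`).  Consequently a
counterexample to ANTI₁-GRADED with the fewest edges has no 2-separation `{u, v}`, `u ≠ v`, with
`a, b, c` on one side and at least two edges on the other.  [this work]
-/

namespace Summit.CriticalPhenomena.PercolationContinuityZ3.Theorems

namespace AntipodalR1

open Finset Relation SimpleGraph

variable {V ι₁ : Type*} [DecidableEq V]

section Contract

variable {ends₁ : ι₁ → Sym2 V} {u v : V}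

/-- **Components of `G₁ + e_O + e_K` versus `G₁ / uv`.**  For `u ≠ v` and each colour, the contraction
has exactly one more component (the isolated vertex `v`). [this work] -/
theorem card_cc_contract_eq [Finite V] (huv : u ≠ v) (ω₁ : ι₁ → Bool) (col : Bool) :
    Nat.card (fromEdgeSet {s : Sym2 V | ∃ e, ω₁ e = col ∧
        (fun i => (ends₁ i).map fun w => if w = v then u else w) e = s}).ConnectedComponent =
      Nat.card (fromEdgeSet {s : Sym2 V | ∃ e, Sum.elim ω₁ id e = col ∧
        Sum.elim ends₁ (fun _ : Bool => s(u, v)) e = s}).ConnectedComponent + 1 := by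
  classical
  set H := fromEdgeSet {s : Sym2 V | ∃ e, Sum.elim ω₁ id e = col ∧
    Sum.elim ends₁ (fun _ : Bool => s(u, v)) e = s} with hH
  set H' := fromEdgeSet {s : Sym2 V | ∃ e, ω₁ e = col ∧
    (fun i => (ends₁ i).map fun w => if w = v then u else w) e = s} with hH'
  -- same reachability off `{v}`
  have hreach : ∀ x y, x ∉ ({v} : Set V) → y ∉ ({v} : Set V) → (H.Reachable x y ↔ H'.Reachable x y) := by
    intro x y hx hy
    simp only [Set.mem_singleton_iff] at hx hy
    rw [hH, hH', reachable_iff_mem_clus, reachable_iff_mem_clus,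
      mem_clus_pair_iff (ends₁ := ends₁) (u := u) (v := v) (ω₁ := ω₁) (a := x) (x := y),
      if_neg hx, if_neg hy]
  -- `v` is isolated in the contraction
  have hiso : ∀ w ∈ ({v} : Set V), ∀ z, ¬ H'.Adj w z := by
    intro w hw z h
    simp only [Set.mem_singleton_iff] at hw
    rw [hw, hH', fromEdgeSet_adj] at h
    obtain ⟨⟨e, -, he⟩, -⟩ := h
    obtain ⟨p', q', hE⟩ : ∃ p' q', ends₁ e = s(p', q') := Sym2.ind (fun p q => ⟨p, q, rfl⟩) (ends₁ e)
    have he' : s(if p' = v then u else p', if q' = v then u else q') = s(v, z) := by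
      rw [← Sym2.map_mk (fun w => if w = v then u else w), ← hE]; exact he
    have hmem : v ∈ s(if p' = v then u else p', if q' = v then u else q') := by
      rw [he']; exact Sym2.mem_mk_left _ _
    rcases Sym2.mem_iff.1 hmem with h1 | h1
    · by_cases hp : p' = v
      · rw [if_pos hp] at h1; exact huv h1.symm
      · rw [if_neg hp] at h1; exact hp h1.symm
    · by_cases hq : q' = v
      · rw [if_pos hq] at h1; exact huv h1.symm
      · rw [if_neg hq] at h1; exact hq h1.symm
  -- no component of the pair system lies inside `{v}` (`u ~ v` through the gadget)
  have hempty : IsEmpty {C : H.ConnectedComponent // ¬ ∃ x, x ∉ ({v} : Set V) ∧ H.connectedComponentMk x = C} := by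
    refine ⟨fun ⟨C, hC⟩ => hC ?_⟩
    obtain ⟨w, hw⟩ := exists_rep_cc C
    by_cases hwv : w = v
    · refine ⟨u, by simpa using huv, ?_⟩
      rw [← hw, hwv]
      have hadj : H.Adj u v := by
        rw [hH, fromEdgeSet_adj]
        exact ⟨⟨Sum.inr col, rfl, rfl⟩, huv⟩
      exact ConnectedComponent.sound hadj.reachable
    · exact ⟨w, by simpa using hwv, hw⟩
  rw [card_cc_eq_meeting_add_inside H' ({v} : Set V), card_cc_eq_meeting_add_inside H ({v} : Set V),
    card_cc_meeting_eq H H' _ hreach, card_cc_inside_eq_card_of_isolated H' _ hiso,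
    @Nat.card_of_isEmpty _ hempty]
  simp

/-- **Grade shift of the contraction.**  For `u ≠ v`: `g_{G₁/uv}(ω₁) = g_{G₁+e_O+e_K}(ω₁ ⊕ id) + 2`.
[this work] -/
theorem grade_contract_eq [Finite V] (huv : u ≠ v) (ω₁ : ι₁ → Bool) :
    (Nat.card (fromEdgeSet {s : Sym2 V | ∃ e, ω₁ e = true ∧
          (fun i => (ends₁ i).map fun w => if w = v then u else w) e = s}).ConnectedComponent +
        Nat.card (fromEdgeSet {s : Sym2 V | ∃ e, ω₁ e = false ∧
          (fun i => (ends₁ i).map fun w => if w = v then u else w) e = s}).ConnectedComponent) =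
      (Nat.card (fromEdgeSet {s : Sym2 V | ∃ e, Sum.elim ω₁ id e = true ∧
          Sum.elim ends₁ (fun _ : Bool => s(u, v)) e = s}).ConnectedComponent +
        Nat.card (fromEdgeSet {s : Sym2 V | ∃ e, Sum.elim ω₁ id e = false ∧
          Sum.elim ends₁ (fun _ : Bool => s(u, v)) e = s}).ConnectedComponent) + 2 := by
  rw [card_cc_contract_eq huv ω₁ true, card_cc_contract_eq huv ω₁ false]
  ring

variable {a b c : V} [Fintype V] [Fintype ι₁] [DecidableEq ι₁]

open Classical in
/-- The graded `L`-fibre of `G₁ + e_O + e_K` at level `t` is the level `t + 2` of `L(G₁ / uv)`.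
[this work] -/
theorem filter_lSet_pair_grade_eq (huv : u ≠ v) (t : ℕ) :
    (univ.filter fun ω₁ : ι₁ → Bool =>
        Sum.elim ω₁ id ∈ lSet (Sum.elim ends₁ (fun _ : Bool => s(u, v))) a b c ∧
        (Nat.card (fromEdgeSet {s : Sym2 V | ∃ e, Sum.elim ω₁ id e = true ∧
          Sum.elim ends₁ (fun _ : Bool => s(u, v)) e = s}).ConnectedComponent +
        Nat.card (fromEdgeSet {s : Sym2 V | ∃ e, Sum.elim ω₁ id e = false ∧
          Sum.elim ends₁ (fun _ : Bool => s(u, v)) e = s}).ConnectedComponent) = t) =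
      (univ.filter fun ω₁ : ι₁ → Bool =>
        ω₁ ∈ lSet (fun i => (ends₁ i).map fun w => if w = v then u else w)
          (if a = v then u else a) (if b = v then u else b) (if c = v then u else c) ∧
        (Nat.card (fromEdgeSet {s : Sym2 V | ∃ e, ω₁ e = true ∧
          (fun i => (ends₁ i).map fun w => if w = v then u else w) e = s}).ConnectedComponent +
        Nat.card (fromEdgeSet {s : Sym2 V | ∃ e, ω₁ e = false ∧
          (fun i => (ends₁ i).map fun w => if w = v then u else w) e = s}).ConnectedComponent) = t + 2) := by
  refine filter_congr fun ω₁ _ => ?_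
  rw [mem_lSet_pair_iff, grade_contract_eq huv ω₁]
  constructor
  · rintro ⟨h1, h2⟩; exact ⟨h1, by omega⟩
  · rintro ⟨h1, h2⟩; exact ⟨h1, by omega⟩

open Classical in
/-- The graded `R`-fibre of `G₁ + e_O + e_K` at level `t` is the level `t + 2` of `R(G₁ / uv)`.
[this work] -/
theorem filter_rSet_pair_grade_eq (huv : u ≠ v) (t : ℕ) :
    (univ.filter fun ω₁ : ι₁ → Bool =>
        Sum.elim ω₁ id ∈ rSet (Sum.elim ends₁ (fun _ : Bool => s(u, v))) a b c ∧
        (Nat.card (fromEdgeSet {s : Sym2 V | ∃ e, Sum.elim ω₁ id e = true ∧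
          Sum.elim ends₁ (fun _ : Bool => s(u, v)) e = s}).ConnectedComponent +
        Nat.card (fromEdgeSet {s : Sym2 V | ∃ e, Sum.elim ω₁ id e = false ∧
          Sum.elim ends₁ (fun _ : Bool => s(u, v)) e = s}).ConnectedComponent) = t) =
      (univ.filter fun ω₁ : ι₁ → Bool =>
        ω₁ ∈ rSet (fun i => (ends₁ i).map fun w => if w = v then u else w)
          (if a = v then u else a) (if b = v then u else b) (if c = v then u else c) ∧
        (Nat.card (fromEdgeSet {s : Sym2 V | ∃ e, ω₁ e = true ∧
          (fun i => (ends₁ i).map fun w => if w = v then u else w) e = s}).ConnectedComponent +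
        Nat.card (fromEdgeSet {s : Sym2 V | ∃ e, ω₁ e = false ∧
          (fun i => (ends₁ i).map fun w => if w = v then u else w) e = s}).ConnectedComponent) = t + 2) := by
  refine filter_congr fun ω₁ _ => ?_
  rw [mem_rSet_pair_iff, grade_contract_eq huv ω₁]
  constructor
  · rintro ⟨h1, h2⟩; exact ⟨h1, by omega⟩
  · rintro ⟨h1, h2⟩; exact ⟨h1, by omega⟩

end Contract

section Reduction

variable {ι₂ : Type*} [Fintype V] [Fintype ι₁] [DecidableEq ι₁] [Fintype ι₂] [DecidableEq ι₂]

open Classical in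
/-- **The graded 2-cut reduction, contraction form.**  `G = G₁ ∪ G₂` glued along `{u, v}` with
`u ≠ v` (part III setting).  If ANTI₁-GRADED holds for `G₁`, for `G₁ + uv` and for the contraction
`G₁ / uv` (system `fun i => (ends₁ i).map π`, apex `π a`, terminals `π b`, `π c`), then ANTI₁-GRADED
holds for `G`, at every level.  No hypothesis on `G₂`. [this work] -/
theorem card_lSet_grade_le_of_twoCut' (ends₁ : ι₁ → Sym2 V) (ends₂ : ι₂ → Sym2 V)
    (u v a b c : V) (huv : u ≠ v)
    (hsep : ∀ w i, w ∈ ends₁ i → ∀ j, w ∈ ends₂ j → w = u ∨ w = v)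
    (ha : ∀ j, a ∈ ends₂ j → a = u ∨ a = v) (hb : ∀ j, b ∈ ends₂ j → b = u ∨ b = v)
    (hc : ∀ j, c ∈ ends₂ j → c = u ∨ c = v)
    (h0 : ∀ t, (univ.filter fun ω₁ : ι₁ → Bool => ω₁ ∈ lSet ends₁ a b c ∧
        (Nat.card (fromEdgeSet {s : Sym2 V | ∃ e, ω₁ e = true ∧ ends₁ e = s}).ConnectedComponent +
        Nat.card (fromEdgeSet {s : Sym2 V | ∃ e, ω₁ e = false ∧ ends₁ e = s}).ConnectedComponent) = t).card ≤
      (univ.filter fun ω₁ : ι₁ → Bool => ω₁ ∈ rSet ends₁ a b c ∧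
        (Nat.card (fromEdgeSet {s : Sym2 V | ∃ e, ω₁ e = true ∧ ends₁ e = s}).ConnectedComponent +
        Nat.card (fromEdgeSet {s : Sym2 V | ∃ e, ω₁ e = false ∧ ends₁ e = s}).ConnectedComponent) = t).card)
    (h1 : ∀ t, (univ.filter fun x : ι₁ ⊕ Unit → Bool =>
        x ∈ lSet (Sum.elim ends₁ (fun _ : Unit => s(u, v))) a b c ∧
        (Nat.card (fromEdgeSet {s : Sym2 V | ∃ e, x e = true ∧
          Sum.elim ends₁ (fun _ : Unit => s(u, v)) e = s}).ConnectedComponent +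
        Nat.card (fromEdgeSet {s : Sym2 V | ∃ e, x e = false ∧
          Sum.elim ends₁ (fun _ : Unit => s(u, v)) e = s}).ConnectedComponent) = t).card ≤
      (univ.filter fun x : ι₁ ⊕ Unit → Bool =>
        x ∈ rSet (Sum.elim ends₁ (fun _ : Unit => s(u, v))) a b c ∧
        (Nat.card (fromEdgeSet {s : Sym2 V | ∃ e, x e = true ∧
          Sum.elim ends₁ (fun _ : Unit => s(u, v)) e = s}).ConnectedComponent +
        Nat.card (fromEdgeSet {s : Sym2 V | ∃ e, x e = false ∧
          Sum.elim ends₁ (fun _ : Unit => s(u, v)) e = s}).ConnectedComponent) = t).card)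
    (h2 : ∀ t, (univ.filter fun ω₁ : ι₁ → Bool =>
        ω₁ ∈ lSet (fun i => (ends₁ i).map fun w => if w = v then u else w)
          (if a = v then u else a) (if b = v then u else b) (if c = v then u else c) ∧
        (Nat.card (fromEdgeSet {s : Sym2 V | ∃ e, ω₁ e = true ∧
          (fun i => (ends₁ i).map fun w => if w = v then u else w) e = s}).ConnectedComponent +
        Nat.card (fromEdgeSet {s : Sym2 V | ∃ e, ω₁ e = false ∧
          (fun i => (ends₁ i).map fun w => if w = v then u else w) e = s}).ConnectedComponent) = t).card ≤
      (univ.filter fun ω₁ : ι₁ → Bool =>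
        ω₁ ∈ rSet (fun i => (ends₁ i).map fun w => if w = v then u else w)
          (if a = v then u else a) (if b = v then u else b) (if c = v then u else c) ∧
        (Nat.card (fromEdgeSet {s : Sym2 V | ∃ e, ω₁ e = true ∧
          (fun i => (ends₁ i).map fun w => if w = v then u else w) e = s}).ConnectedComponent +
        Nat.card (fromEdgeSet {s : Sym2 V | ∃ e, ω₁ e = false ∧
          (fun i => (ends₁ i).map fun w => if w = v then u else w) e = s}).ConnectedComponent) = t).card)
    (t : ℕ) :
    (univ.filter fun x : ι₁ ⊕ ι₂ → Bool => x ∈ lSet (Sum.elim ends₁ ends₂) a b c ∧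
        (Nat.card (fromEdgeSet {s : Sym2 V | ∃ e, x e = true ∧
          Sum.elim ends₁ ends₂ e = s}).ConnectedComponent +
        Nat.card (fromEdgeSet {s : Sym2 V | ∃ e, x e = false ∧
          Sum.elim ends₁ ends₂ e = s}).ConnectedComponent) = t).card ≤
      (univ.filter fun x : ι₁ ⊕ ι₂ → Bool => x ∈ rSet (Sum.elim ends₁ ends₂) a b c ∧
        (Nat.card (fromEdgeSet {s : Sym2 V | ∃ e, x e = true ∧
          Sum.elim ends₁ ends₂ e = s}).ConnectedComponent +
        Nat.card (fromEdgeSet {s : Sym2 V | ∃ e, x e = false ∧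
          Sum.elim ends₁ ends₂ e = s}).ConnectedComponent) = t).card := by
  refine card_lSet_grade_le_of_twoCut ends₁ ends₂ u v a b c hsep ha hb hc h0 h1 (fun t' => ?_) t
  rw [filter_lSet_pair_grade_eq huv, filter_rSet_pair_grade_eq huv]
  exact h2 _

end Reduction

end AntipodalR1

end Summit.CriticalPhenomena.PercolationContinuityZ3.Theorems
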